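import Summits.QuantumAdvantage.QuantumAdvantage.Theorems.RingFrameRingToElimStubs
import Summits.QuantumAdvantage.AdviceFreeQNC0.LowDegreeGapStrategies
import HarnessLib

/-!
# Route RingFrame, crux α `RingToElim` (stmt-QuantumAdvantage-19119): α IS ITS EVERYWHERE-DENSE
# CASE — hardness for dense walk strategies alone gives `RingHardU`, `RingToElim`, the rung leaf

The low-degree gap theorem (`ringWinU_lowDegGap_le`, `LowDegreeGapStrategies.lean`, p471956):
there is `θ₂ < 1` such that for every `C` and all large `n`, a walk strategy of degree
`≤ (log₂ n)^C` that selects no position strictly inside some run `(p, p + ℓ)` of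
`ℓ = (log₂ n)^{2C+1}` positions wins the ring game in walk coordinates on at most `θ₂·2ⁿ`
inputs.  Hence the crux `RingHardU` (all polylog-degree walk strategies) follows from its
restriction to EVERYWHERE-DENSE strategies — those having, inside every run
`(p, p + (log₂ n)^{2C+1})` with `p + (log₂ n)^{2C+1} ≤ n`, a position whose selector is not
identically false — with the constant `max θ₁ θ₂`:

* `ringHardU_of_denseHard` — dense hardness (hypothesis stated inline, the shape of `RingHardU`
  with the density premise added) `→ RingHardU`;
* `ringHard_two_of_denseHard`, `ringToElim_of_denseHard` — then `RingHard 2` (`stub_transport`)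
  and the crux `RingToElim` BY NAME (whence the rung leaf via `bridgeRingToSep_proof`).

So a line on α may assume density for free.  The cell's statement (prover qn-prover-3); not in
print.  WHAT THIS IS NOT: dense hardness is NOT proved (it is α proper: e.g. the strategies that
bet at every position, or local rules of every range, are dense); conditional results credit
nothing; no separation.
-/

-- the sub-problem namespace `Summit.QuantumAdvantage.QuantumAdvantage` repeats the summit name by design (D-0017)
set_option linter.dupNamespace false

noncomputable section

namespace Summit.QuantumAdvantage.QuantumAdvantage.Theorems

open Finset Summit.QuantumAdvantage.AdviceFreeQNC0 RingToElim
open Literature.Computability.MetaComplexity Literature.Computability.MetaComplexity.Smolensky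

/-- **α is its dense case.**  If there is `θ < 1` such that for every `C` and all large `n`
every EVERYWHERE-DENSE walk strategy of degree `≤ (log₂ n)^C` (some selector not identically
false inside every run `(p, p + (log₂ n)^{2C+1})`, `p + (log₂ n)^{2C+1} ≤ n`) wins the ring game
at charge `n + 2` on at most `θ·2ⁿ` inputs, then `RingHardU` (all strategies): a non-dense
strategy has a clean run and the low-degree gap theorem `ringWinU_lowDegGap_le` bounds it.
(Cell statement; conditional on the dense hypothesis.) -/
theorem ringHardU_of_denseHard
    (h : ∃ θ : ℝ, θ < 1 ∧ ∀ C : ℕ, ∃ n₀ : ℕ, ∀ n ≥ n₀, ∀ y : Fin (n + 1) → (Fin n → Bool) → Bool,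
      (∀ g, HasDeg (y g) ((Nat.log 2 n) ^ C)) →
      (∀ p : ℕ, p + (Nat.log 2 n) ^ (2 * C + 1) ≤ n →
        ∃ g : Fin (n + 1), p < g.val ∧ g.val < p + (Nat.log 2 n) ^ (2 * C + 1) ∧ ∃ u, y g u = true) →
        ((univ.filter fun u : Fin n → Bool => ringWinU (n + 2) y u = true).card : ℝ) ≤
          θ * (2 : ℝ) ^ n) :
    RingHardU := by
  obtain ⟨θ₁, hθ₁, h₁⟩ := h
  obtain ⟨θ₂, hθ₂, h₂⟩ := ringWinU_lowDegGap_le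
  refine ⟨max θ₁ θ₂, max_lt hθ₁ hθ₂, fun C => ?_⟩
  obtain ⟨n₁, hn₁⟩ := h₁ C
  obtain ⟨n₂, hn₂⟩ := h₂ C
  refine ⟨max n₁ n₂, fun n hn y hdeg => ?_⟩
  have hn₁n : n₁ ≤ n := le_trans (le_max_left _ _) hn
  have hn₂n : n₂ ≤ n := le_trans (le_max_right _ _) hn
  have hpow : (0 : ℝ) ≤ (2 : ℝ) ^ n := by positivity
  by_cases hdense : ∀ p : ℕ, p + (Nat.log 2 n) ^ (2 * C + 1) ≤ n →
      ∃ g : Fin (n + 1), p < g.val ∧ g.val < p + (Nat.log 2 n) ^ (2 * C + 1) ∧ ∃ u, y g u = true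
  · -- dense: the hypothesis
    calc ((univ.filter fun u : Fin n → Bool => ringWinU (n + 2) y u = true).card : ℝ)
        ≤ θ₁ * (2 : ℝ) ^ n := hn₁ n hn₁n y hdeg hdense
      _ ≤ max θ₁ θ₂ * (2 : ℝ) ^ n := mul_le_mul_of_nonneg_right (le_max_left _ _) hpow
  · -- not dense: a clean run, the gap theorem
    push Not at hdense
    obtain ⟨p, hp, hclean⟩ := hdense
    have hgap : ∀ g : Fin (n + 1), p < g.val → g.val < p + (Nat.log 2 n) ^ (2 * C + 1) →
        ∀ u, y g u = false := by
      intro g hg1 hg2 u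
      have h := hclean g hg1 hg2 u
      simpa using h
    calc ((univ.filter fun u : Fin n → Bool => ringWinU (n + 2) y u = true).card : ℝ)
        ≤ θ₂ * (2 : ℝ) ^ n := hn₂ n hn₂n p _ hp le_rfl (n + 2) y hdeg hgap
      _ ≤ max θ₁ θ₂ * (2 : ℝ) ^ n := mul_le_mul_of_nonneg_right (le_max_right _ _) hpow

/-- **Dense hardness gives the rung statement `RingHard 2`** (through `stub_transport`). -/
theorem ringHard_two_of_denseHard
    (h : ∃ θ : ℝ, θ < 1 ∧ ∀ C : ℕ, ∃ n₀ : ℕ, ∀ n ≥ n₀, ∀ y : Fin (n + 1) → (Fin n → Bool) → Bool,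
      (∀ g, HasDeg (y g) ((Nat.log 2 n) ^ C)) →
      (∀ p : ℕ, p + (Nat.log 2 n) ^ (2 * C + 1) ≤ n →
        ∃ g : Fin (n + 1), p < g.val ∧ g.val < p + (Nat.log 2 n) ^ (2 * C + 1) ∧ ∃ u, y g u = true) →
        ((univ.filter fun u : Fin n → Bool => ringWinU (n + 2) y u = true).card : ℝ) ≤
          θ * (2 : ℝ) ^ n) :
    Summit.QuantumAdvantage.AdviceFreeQNC0.RingHard 2 :=
  stub_transport (ringHardU_of_denseHard h)

/-- **Dense hardness gives the crux α `RingToElim` by name** (its antecedent `ElimHard` is not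
even needed: it is a theorem, `elimHard_holds`). -/
theorem ringToElim_of_denseHard
    (h : ∃ θ : ℝ, θ < 1 ∧ ∀ C : ℕ, ∃ n₀ : ℕ, ∀ n ≥ n₀, ∀ y : Fin (n + 1) → (Fin n → Bool) → Bool,
      (∀ g, HasDeg (y g) ((Nat.log 2 n) ^ C)) →
      (∀ p : ℕ, p + (Nat.log 2 n) ^ (2 * C + 1) ≤ n →
        ∃ g : Fin (n + 1), p < g.val ∧ g.val < p + (Nat.log 2 n) ^ (2 * C + 1) ∧ ∃ u, y g u = true) →
        ((univ.filter fun u : Fin n → Bool => ringWinU (n + 2) y u = true).card : ℝ) ≤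
          θ * (2 : ℝ) ^ n) :
    Summit.QuantumAdvantage.QuantumAdvantage.Theses.RingFrame.RingToElim :=
  fun _ => ringHard_two_of_denseHard h

end Summit.QuantumAdvantage.QuantumAdvantage.Theorems
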